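import Summits.Ventures.LatticeQCDFlow.Exactness.NCMCGeneralSpaceTauIntWindowConsistency
import Summits.Ventures.LatticeQCDFlow.Scoring.MadrasSokalDataWindow
import Summits.Ventures.LatticeQCDFlow.Scoring.LogRatioAgreementCLT

/-!
# MARKOV-CHAIN DATA: scorer A/B's data-chosen Madras–Sokal window on the output of a chain with a Doeblin power converges to the population window, from EVERY initial law

HONEST FRAMING: exact (Metropolis-corrected) sampling algorithms for lattice gauge theory;
figures of merit are autocorrelation/cost numbers at stated couplings and volumes; no
continuum-physics claim.

Venture `LatticeQCDFlow` (cell pub-lqcd), sub-topic `Scoring`; FANOUT row 16 (`su2-base`), GEN-8.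
NEW WORK of the cell — the docking of row 13's per-lag consistency for chains with a Doeblin power
(`Exactness/NCMCGeneralSpaceTauIntWindowConsistency.chain_gammaHat_tendstoInMeasure_of_nHit`: the
printed `Γ̂_N(t) → C_f̄(t)` in `P_{μ₀}`-measure for EVERY initial law `μ₀`) with GEN-8's
`Scoring/MadrasSokalDataWindow` (transfer at a strict crossing); tools from row 4's
`LogRatioAgreementCLT` / `MultivariateDeltaMethod`.  No definition; nothing cited as a fact.

Row 13's file proves consistency of scorer A's printed `τ̂_{N,W_N}` at DETERMINISTIC windows GROWING
with `N` (and `…GammaMethodDataWindow` for clipped data-dependent rules in that regime) and lists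
'the automatic window' as NOT CLAIMED.  THIS FILE treats the FIXED-`c` Madras–Sokal rule the scorers
run (scorer B's window of record `c = 6`, scorer A's cross-check scan), at fixed autocorrelations:

* **`chain_rhoHat_tendstoInMeasure_of_nHit`** — every printed autocorrelation is consistent:
  `ρ̂_N(t) = Γ̂_N(t)/Γ̂_N(0) → ρ(t) = C_f̄(t)/C_f̄(0)` in `P_{μ₀}`-measure (`Var_π f = C_f̄(0) > 0`).
* **`chain_tauIntWindow_fixed_tendstoInMeasure_of_nHit`** — at every FIXED window `W`:
  `τ̂_N(W) = tauIntWindow ρ̂_N W → τ_W = tauIntWindow ρ W` in `P_{μ₀}`-measure (induction on `W`).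
* **`chain_tendsto_measure_msWindowSel_ne_of_nHit`** — if the population curve `W ↦ τ_W` has a STRICT
  Madras–Sokal window `w` at `c > 0`, then for ANY selector `Ŵ_N` returning `w` whenever `w` is the MS
  window of the empirical curve (scorer B's `ms_window` with `w ≤ W_max`: GEN-8
  `Scoring/MadrasSokalWindowSelector.msWindowSel_eq_of_isMSWindow`), `P_{μ₀}(Ŵ_N ≠ w) → 0` from
  EVERY initial law — the scorer's window of record on chain output is asymptotically the population
  window; `chain_tendsto_measure_not_isMSWindow_of_nHit` (selector-free form).

NOT CLAIMED: a CLT for `τ̂` on chain data (row 13's `…GammaMethodStudentizedCLT` is for the variance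
statistic at growing windows; the fixed-window law of `τ̂_W` for chains is not typed); tangential
crossings; rates; any number of ours.
-/

noncomputable section

open MeasureTheory ProbabilityTheory Filter Finset
open scoped Topology ENNReal
open Summit.Ventures.LatticeQCDFlow.Exactness.GeneralNCMC Summit.Ventures.LatticeQCDFlow.Exactness

namespace Summit.Ventures.LatticeQCDFlow.Scoring

section Chain

variable {S : Type*} [MeasurableSpace S]
  {κ : Kernel S S} [IsMarkovKernel κ] {π : Measure S} [IsProbabilityMeasure π]
  {ν : Measure S} [IsProbabilityMeasure ν] {ε : ℝ≥0∞} {m : ℕ}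
  (μ₀ : Measure S) [IsProbabilityMeasure μ₀]

/-- **Every printed autocorrelation is consistent on chain data**: `ρ̂_N(t) → C_f̄(t)/C_f̄(0)` in
`P_{μ₀}`-measure for every initial law (`κ` Markov, `π` invariant, `(nHit κ m)(z,·) ≥ ε ν`, `ε ≠ 0`,
`0 < m`, `|f| ≤ C` measurable, `C_f̄(0) > 0`). -/
theorem chain_rhoHat_tendstoInMeasure_of_nHit (hπ : Kernel.Invariant κ π)
    (hε : ε ≠ 0) (hmin : ∀ z, ε • ν ≤ nHit κ m z) (hm : 0 < m)
    {f : S → ℝ} (hf : Measurable f) {C : ℝ} (hC : ∀ x, |f x| ≤ C)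
    (hvar : 0 < Scoring.autocov κ π (fun y => f y - ∫ z, f z ∂π) 0) (t : ℕ) :
    TendstoInMeasure (Kernel.trajMeasure (X := fun _ : ℕ => S) μ₀
        (fun n : ℕ => κ.comap (fun h : (i : ↥(Finset.Iic n)) → S => h ⟨n, Finset.mem_Iic.2 le_rfl⟩)
          (measurable_pi_apply _)))
      (fun (N : ℕ) (x : ℕ → S) => Scoring.rhoHat (fun i => f (x i)) N t)
      atTop (fun _ => Scoring.autocov κ π (fun y => f y - ∫ z, f z ∂π) t
        / Scoring.autocov κ π (fun y => f y - ∫ z, f z ∂π) 0) := by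
  have hU := chain_gammaHat_tendstoInMeasure_of_nHit μ₀ hπ hε hmin hm hf hC t
  have hV := chain_gammaHat_tendstoInMeasure_of_nHit μ₀ hπ hε hmin hm hf hC 0
  have h := CardConsistency.tendstoInMeasure_comp_continuousAt_normed
    (CardConsistency.tendstoInMeasure_prodMk hU hV) (φ := fun q : ℝ × ℝ => q.1 / q.2)
    (continuousAt_fst.div continuousAt_snd hvar.ne')
  simpa only [Scoring.rhoHat] using h

/-- **`τ̂_N(W) → τ_W` in `P_{μ₀}`-measure at every FIXED window** (induction on `W`). -/
theorem chain_tauIntWindow_fixed_tendstoInMeasure_of_nHit (hπ : Kernel.Invariant κ π)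
    (hε : ε ≠ 0) (hmin : ∀ z, ε • ν ≤ nHit κ m z) (hm : 0 < m)
    {f : S → ℝ} (hf : Measurable f) {C : ℝ} (hC : ∀ x, |f x| ≤ C)
    (hvar : 0 < Scoring.autocov κ π (fun y => f y - ∫ z, f z ∂π) 0) (W : ℕ) :
    TendstoInMeasure (Kernel.trajMeasure (X := fun _ : ℕ => S) μ₀
        (fun n : ℕ => κ.comap (fun h : (i : ↥(Finset.Iic n)) → S => h ⟨n, Finset.mem_Iic.2 le_rfl⟩)
          (measurable_pi_apply _)))
      (fun (N : ℕ) (x : ℕ → S) => Scoring.tauIntWindow (Scoring.rhoHat (fun i => f (x i)) N) W)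
      atTop (fun _ => Scoring.tauIntWindow (fun t => Scoring.autocov κ π (fun y => f y - ∫ z, f z ∂π) t
        / Scoring.autocov κ π (fun y => f y - ∫ z, f z ∂π) 0) W) := by
  induction W with
  | zero =>
    simp only [Scoring.tauIntWindow, sum_range_zero, add_zero]
    exact tendstoInMeasure_of_tendsto_ae (fun _ => aestronglyMeasurable_const)
      (Eventually.of_forall fun _ => tendsto_const_nhds)
  | succ W ih =>
    have hρ := chain_rhoHat_tendstoInMeasure_of_nHit μ₀ hπ hε hmin hm hf hC hvar (W + 1)
    have h := CardConsistency.tendstoInMeasure_comp_continuousAt_normed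
      (CardConsistency.tendstoInMeasure_prodMk ih hρ) (φ := fun q : ℝ × ℝ => q.1 + q.2)
      (by fun_prop : Continuous fun q : ℝ × ℝ => q.1 + q.2).continuousAt
    simpa only [Scoring.tauIntWindow, sum_range_succ, add_assoc] using h

/-- **Selector-free form**: at a strict population crossing `w` (`c > 0`), the probability that `w`
is NOT the Madras–Sokal window of the empirical curve `W ↦ τ̂_N(W)` tends to `0`, every `μ₀`. -/
theorem chain_tendsto_measure_not_isMSWindow_of_nHit (hπ : Kernel.Invariant κ π)
    (hε : ε ≠ 0) (hmin : ∀ z, ε • ν ≤ nHit κ m z) (hm : 0 < m)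
    {f : S → ℝ} (hf : Measurable f) {C : ℝ} (hC : ∀ x, |f x| ≤ C)
    (hvar : 0 < Scoring.autocov κ π (fun y => f y - ∫ z, f z ∂π) 0) {c : ℝ} (hc : 0 < c) {w : ℕ}
    (hw : IsStrictMSWindow c (fun W => Scoring.tauIntWindow (fun t =>
      Scoring.autocov κ π (fun y => f y - ∫ z, f z ∂π) t
        / Scoring.autocov κ π (fun y => f y - ∫ z, f z ∂π) 0) W) w) :
    Tendsto (fun N : ℕ => (Kernel.trajMeasure (X := fun _ : ℕ => S) μ₀
        (fun n : ℕ => κ.comap (fun h : (i : ↥(Finset.Iic n)) → S => h ⟨n, Finset.mem_Iic.2 le_rfl⟩)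
          (measurable_pi_apply _)))
      {x | ¬ IsMSWindow c (fun W => Scoring.tauIntWindow (Scoring.rhoHat (fun i => f (x i)) N) W) w})
      atTop (𝓝 0) := by
  set τhat : ℕ → ℕ → (ℕ → S) → ℝ := fun N W x =>
    Scoring.tauIntWindow (Scoring.rhoHat (fun i => f (x i)) N) W with hτhat
  have hconv : ∀ W, 1 ≤ W → W ≤ w → TendstoInMeasure _ (fun N => τhat N W) atTop fun _ =>
      Scoring.tauIntWindow (fun t => Scoring.autocov κ π (fun y => f y - ∫ z, f z ∂π) t
        / Scoring.autocov κ π (fun y => f y - ∫ z, f z ∂π) 0) W :=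
    fun W _ _ => chain_tauIntWindow_fixed_tendstoInMeasure_of_nHit μ₀ hπ hε hmin hm hf hC hvar W
  exact tendsto_measure_not_isMSWindow hc hw hconv

/-- **THE SCORER'S WINDOW ON CHAIN OUTPUT IS ASYMPTOTICALLY THE POPULATION WINDOW.**  Under the same
hypotheses, for ANY selector `Ŵ_N(x)` that returns `w` whenever `w` is the Madras–Sokal window of the
empirical curve (scorer B's `ms_window` with `w ≤ W_max`), `P_{μ₀}(Ŵ_N ≠ w) → 0` from EVERY
initial law `μ₀`. -/
theorem chain_tendsto_measure_msWindowSel_ne_of_nHit (hπ : Kernel.Invariant κ π)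
    (hε : ε ≠ 0) (hmin : ∀ z, ε • ν ≤ nHit κ m z) (hm : 0 < m)
    {f : S → ℝ} (hf : Measurable f) {C : ℝ} (hC : ∀ x, |f x| ≤ C)
    (hvar : 0 < Scoring.autocov κ π (fun y => f y - ∫ z, f z ∂π) 0) {c : ℝ} (hc : 0 < c) {w : ℕ}
    (hw : IsStrictMSWindow c (fun W => Scoring.tauIntWindow (fun t =>
      Scoring.autocov κ π (fun y => f y - ∫ z, f z ∂π) t
        / Scoring.autocov κ π (fun y => f y - ∫ z, f z ∂π) 0) W) w)
    {Wsel : ℕ → (ℕ → S) → ℕ}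
    (hsel : ∀ N x, IsMSWindow c (fun W => Scoring.tauIntWindow (Scoring.rhoHat (fun i => f (x i)) N) W) w
      → Wsel N x = w) :
    Tendsto (fun N : ℕ => (Kernel.trajMeasure (X := fun _ : ℕ => S) μ₀
        (fun n : ℕ => κ.comap (fun h : (i : ↥(Finset.Iic n)) → S => h ⟨n, Finset.mem_Iic.2 le_rfl⟩)
          (measurable_pi_apply _))) {x | Wsel N x ≠ w}) atTop (𝓝 0) := by
  set τhat : ℕ → ℕ → (ℕ → S) → ℝ := fun N W x =>
    Scoring.tauIntWindow (Scoring.rhoHat (fun i => f (x i)) N) W with hτhat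
  have hconv : ∀ W, 1 ≤ W → W ≤ w → TendstoInMeasure _ (fun N => τhat N W) atTop fun _ =>
      Scoring.tauIntWindow (fun t => Scoring.autocov κ π (fun y => f y - ∫ z, f z ∂π) t
        / Scoring.autocov κ π (fun y => f y - ∫ z, f z ∂π) 0) W :=
    fun W _ _ => chain_tauIntWindow_fixed_tendstoInMeasure_of_nHit μ₀ hπ hε hmin hm hf hC hvar W
  have hsel' : ∀ N x, IsMSWindow c (fun W => τhat N W x) w → Wsel N x = w := hsel
  exact tendsto_measure_msWindowSel_ne hc hw hconv hsel'

end Chain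

end Summit.Ventures.LatticeQCDFlow.Scoring

end
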